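import Mathlib
import Literature.AlgebraicGeometry.Resolution.PointBlowupFlagInvariant
import Literature.AlgebraicGeometry.Resolution.PointBlowupHeightVectorDrops
import Literature.AlgebraicGeometry.Resolution.PointBlowupFlagShiftBound
import Literature.AlgebraicGeometry.Resolution.ShearedBinaryFormOrder
import Summits.ResolutionOfSingularities.ResolutionOfSingularities.Theorems.WeightedInvariantLocalWeightedDropInsepCleaning
import Summits.ResolutionOfSingularities.ResolutionOfSingularities.Theorems.WeightedInvariantLocalWeightedDropInsepNewtonMeasures
import Summits.ResolutionOfSingularities.ResolutionOfSingularities.Theorems.WeightedInvariantLocalWeightedDropInsepNewtonVMove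
import Summits.ResolutionOfSingularities.ResolutionOfSingularities.Theorems.WeightedInvariantLocalWeightedDropInsepNewtonVHeight
import Summits.ResolutionOfSingularities.ResolutionOfSingularities.Theorems.WeightedInvariantLocalWeightedDropInsepNewtonHMove
import Summits.ResolutionOfSingularities.ResolutionOfSingularities.Theorems.WeightedInvariantLocalWeightedDropInsepNewtonClean
import Summits.ResolutionOfSingularities.ResolutionOfSingularities.Theorems.WeightedInvariantLocalWeightedDropInsepNewtonShear

/-!
# `WeightedInvariant.LocalWeightedDrop`, line `hasse-ridge-face-selection`: the TRANSLATIONAL successor (Hauser–Wagner's move (T)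
# `F(yz + tz, z)/z²`) — re-cleaned shear and Moh's bound `deg_y(F*) ≤ height(F) + parity(d)` (unit M4, second part)

Crux item stmt-ResolutionOfSingularities-8899 `LocalWeightedDrop` (route `ResolutionOfSingularities/WeightedInvariant`),
serving the door `WeightedConstruction` stmt-ResolutionOfSingularities-0571.  [OURS · L1 W4.3, chain w43, stub worker 3
(gen 3): unit M4 of L/res-L1-w43-stub-3/S2iM-ATTACK-PLAN.md (key S2iM `stub_charTwoInseparableReductionWon`); the
mathematics is Hauser–Wagner, L'Enseignement Math. 60 (2014) §6.1 (T), Lemma 1 + Lemma 3 (pp. 201–203), built on res-lit-5's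
kernel proof of Lemma 2 = Moh's bound (`Literature/…/ShearedBinaryFormOrder.lean`, p483027); NOT a statement of any manuscript.]

Characteristic `2`, orientation BEFORE the move free `= 0`, rigid `= 1`; a (T)-point is reached — in every flag-adapted presentation —
by a triangular shear `θ_φ : x₀ ↦ x₀ + φ(x₁)` with LINEAR PART `t = [z¹]φ ≠ 0`, then re-cleaning `G = clean₂(θ_φ^* F)` and the horizontal
chart `π_H : x₁ ↦ c₁X₀, x₀ ↦ X₀X₁` (`π_H^* G = X₀² A″`; new rigid `= 0`, free `= 1`).  For a CLEAN `F ≠ 0` of order `d ≥ 2`: `cleanShear_*`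
(`G ≠ 0`, `ord G = d`, row `β₁`, `β₁`, `α₁` kept — any `φ`); `exists_initial_coeff_cleanShear` (**[HW14] Lemma 3 with Lemma 2**: for `t ≠ 0`
the cleaned initial form of `θ_φ^* F` has a point `(i, d − i)`, `i ≤ height(F) + parity(d)`; Lemma 1 = `height_initialPoly_le_heightPS`);
`degAlongPS_tSucc_le` / `heightPS_tSucc_add_le`: **`deg_free(A″) ≤ height(F) + parity(d)`** — [HW14] Prop. 2's chain before the bonus
arithmetic (arithmetic and the lift's chart bookkeeping: `…InsepNewtonTChart`).
-/

set_option linter.dupNamespace false -- mandated namespace of this single-conjunct summit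

namespace Summit.ResolutionOfSingularities.ResolutionOfSingularities.Theorems

namespace InsepNewton

open MvPowerSeries
open Literature.AlgebraicGeometry.Resolution
open Literature.AlgebraicGeometry.Resolution.HauserPerlega2024 (ordAlong cleanSeries)
open Literature.AlgebraicGeometry.Resolution.HauserWagner2014 (ordVarPS degAlongPS heightPS)

variable {K : Type} [Field K]

/-! ### Lemma 1's bookkeeping: the dehomogenised initial form has `ord_y ≤ trailing degree ≤ degree ≤ α₁` -/

/-- Coefficients of the dehomogenised initial form `f = Σ_{b ≤ d} [x₀^b x₁^{d−b}]H · Y^b`. -/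
theorem coeff_initialPoly (H : MvPowerSeries (Fin 2) K) (d b : ℕ) :
    (∑ b ∈ Finset.range (d + 1), Polynomial.monomial b (coeff (Finsupp.single 0 b + Finsupp.single 1 (d - b)) H)).coeff b =
      if b ≤ d then coeff (Finsupp.single 0 b + Finsupp.single 1 (d - b)) H else 0 := by
  simp only [Polynomial.finsetSum_coeff, Polynomial.coeff_monomial, Finset.sum_ite_eq', Finset.mem_range, Nat.lt_succ_iff]

/-- **`deg(f) ≤ α₁`**: a point `(b, d − b)` of the initial line with `b > α₁` would lie below the row `β₁` (`d ≤ α₁ + β₁`). -/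
theorem natDegree_initialPoly_le_degAlongPS {H : MvPowerSeries (Fin 2) K} (hH : H ≠ 0) {d : ℕ} (hd : H.order.toNat = d) :
    (∑ b ∈ Finset.range (d + 1), Polynomial.monomial b (coeff (Finsupp.single 0 b + Finsupp.single 1 (d - b)) H)).natDegree
      ≤ degAlongPS H 1 0 := by
  rw [Polynomial.natDegree_le_iff_coeff_eq_zero]
  intro b hb
  rw [coeff_initialPoly]
  split_ifs with hbd
  · -- the vertex has degree `≥ d`
    have hv := coeff_vertex_ne_zero hH
    have hvd := order_toNat_le_of_coeff_ne_zero hv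
    rw [pair_apply_one, pair_apply_zero, one_mul, hd] at hvd
    by_contra hne
    have h1 := ordVarPS_le 1 hne
    rw [pair_apply_one] at h1
    omega
  · rfl

/-- **`ord_y ≤ trailing degree of f`**: every point of `H` has free exponent `≥ ord_y H`. -/
theorem ordVarPS_le_natTrailingDegree_initialPoly {H : MvPowerSeries (Fin 2) K} (hH : H ≠ 0) {d : ℕ} (hd : H.order.toNat = d) :
    ordVarPS H 0 ≤ (∑ b ∈ Finset.range (d + 1),
      Polynomial.monomial b (coeff (Finsupp.single 0 b + Finsupp.single 1 (d - b)) H)).natTrailingDegree := by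
  refine Polynomial.le_natTrailingDegree (initialPoly_ne_zero hH hd) fun b hb => ?_
  rw [coeff_initialPoly]
  split_ifs with hbd
  · by_contra hne
    have h0 := ordVarPS_le 0 hne
    rw [pair_apply_zero] at h0
    omega
  · rfl

/-- **[HW14] Lemma 1 in the form used**: `height(F_d) = deg f − trailing-deg f ≤ height(F) = α₁ − ord_y`. [cite: HauserWagner2014, §6.1 Lemma 1 p. 201] -/
theorem height_initialPoly_le_heightPS {H : MvPowerSeries (Fin 2) K} (hH : H ≠ 0) {d : ℕ} (hd : H.order.toNat = d) :
    (∑ b ∈ Finset.range (d + 1), Polynomial.monomial b (coeff (Finsupp.single 0 b + Finsupp.single 1 (d - b)) H)).natDegree -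
      (∑ b ∈ Finset.range (d + 1),
        Polynomial.monomial b (coeff (Finsupp.single 0 b + Finsupp.single 1 (d - b)) H)).natTrailingDegree ≤ heightPS H 1 0 := by
  have h1 := natDegree_initialPoly_le_degAlongPS hH hd; have h2 := ordVarPS_le_natTrailingDegree_initialPoly hH hd
  rw [heightPS]; omega

/-- A CLEAN `H` and an EVEN `d`: every point `(b, d − b)` of the initial line has `b` odd. -/
theorem odd_of_coeff_initial_ne_zero {H : MvPowerSeries (Fin 2) K} (hclean : cleanSeries 2 H = H) {d b : ℕ} (hd2 : 2 ∣ d)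
    (hbd : b ≤ d) (hb : coeff (Finsupp.single 0 b + Finsupp.single 1 (d - b)) H ≠ 0) : ¬ 2 ∣ b := by
  intro h2b
  rw [isClean_iff] at hclean
  refine hb (hclean _ ((forall_two_dvd_pair_iff _ _).mpr ⟨h2b, ?_⟩))
  obtain ⟨m, hm⟩ := hd2; obtain ⟨n, hn⟩ := h2b
  exact ⟨m - n, by omega⟩

/-! ### The re-cleaned shear `G = clean₂(θ_φ^* H)` of a clean `H` -/

/-- The coefficients of `G = clean₂(θ_φ^* H)` off the square lattice are those of `θ_φ^* H`. -/
theorem coeff_cleanShear_of_not_dvd (φ : PowerSeries K) (H : MvPowerSeries (Fin 2) K) {a b : ℕ} (h : ¬ (2 ∣ a ∧ 2 ∣ b)) :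
    coeff (Finsupp.single 0 a + Finsupp.single 1 b) (cleanSeries 2 (subst (fun l : Fin 2 => if l = 0 then
      (X 0 : MvPowerSeries (Fin 2) K) + PowerSeries.subst (X 1 : MvPowerSeries (Fin 2) K) φ else X l) H)) =
      coeff (Finsupp.single 0 a + Finsupp.single 1 b) (subst (fun l : Fin 2 => if l = 0 then
        (X 0 : MvPowerSeries (Fin 2) K) + PowerSeries.subst (X 1 : MvPowerSeries (Fin 2) K) φ else X l) H) := by
  classical
  rw [InsepCleaning.coeff_cleanSeries, if_neg]
  rwa [forall_two_dvd_pair_iff]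

/-- A support point of `G` is a support point of `θ_φ^* H`. -/
theorem coeff_shear_ne_zero_of_cleanShear (φ : PowerSeries K) (H : MvPowerSeries (Fin 2) K) {e : Fin 2 →₀ ℕ}
    (h : coeff e (cleanSeries 2 (subst (fun l : Fin 2 => if l = 0 then
      (X 0 : MvPowerSeries (Fin 2) K) + PowerSeries.subst (X 1 : MvPowerSeries (Fin 2) K) φ else X l) H)) ≠ 0) :
    coeff e (subst (fun l : Fin 2 => if l = 0 then
      (X 0 : MvPowerSeries (Fin 2) K) + PowerSeries.subst (X 1 : MvPowerSeries (Fin 2) K) φ else X l) H) ≠ 0 := by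
  classical
  rw [InsepCleaning.coeff_cleanSeries] at h
  split_ifs at h with hall
  · exact absurd rfl h
  · exact h

/-- **THE ROW `β₁` OF `G` IS THE ROW `β₁` OF `H`** (`H` clean). -/
theorem coeff_cleanShear_row {φ : PowerSeries K} (hφ : PowerSeries.constantCoeff φ = 0) {H : MvPowerSeries (Fin 2) K}
    (hclean : cleanSeries 2 H = H) (i : ℕ) :
    coeff (Finsupp.single 0 i + Finsupp.single 1 (ordVarPS H 1)) (cleanSeries 2 (subst (fun l : Fin 2 => if l = 0 then
      (X 0 : MvPowerSeries (Fin 2) K) + PowerSeries.subst (X 1 : MvPowerSeries (Fin 2) K) φ else X l) H)) =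
      coeff (Finsupp.single 0 i + Finsupp.single 1 (ordVarPS H 1)) H := by
  classical
  rw [InsepCleaning.coeff_cleanSeries]
  split_ifs with hall
  · rw [isClean_iff] at hclean
    exact (hclean _ hall).symm
  · exact coeff_shear_row hφ H i

/-- `G ≠ 0`: the highest vertex of the clean `H ≠ 0` survives shear and cleaning. -/
theorem cleanShear_ne_zero {φ : PowerSeries K} (hφ : PowerSeries.constantCoeff φ = 0) {H : MvPowerSeries (Fin 2) K}
    (hH : H ≠ 0) (hclean : cleanSeries 2 H = H) :
    cleanSeries 2 (subst (fun l : Fin 2 => if l = 0 then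
      (X 0 : MvPowerSeries (Fin 2) K) + PowerSeries.subst (X 1 : MvPowerSeries (Fin 2) K) φ else X l) H) ≠ 0 := by
  intro h
  have := coeff_cleanShear_row hφ hclean (degAlongPS H 1 0)
  rw [h, map_zero] at this
  exact coeff_vertex_ne_zero hH this.symm

/-- **`β₁(G) = β₁(H)`**. -/
theorem ordVarPS_cleanShear_one {φ : PowerSeries K} (hφ : PowerSeries.constantCoeff φ = 0) {H : MvPowerSeries (Fin 2) K}
    (hH : H ≠ 0) (hclean : cleanSeries 2 H = H) :
    ordVarPS (cleanSeries 2 (subst (fun l : Fin 2 => if l = 0 then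
      (X 0 : MvPowerSeries (Fin 2) K) + PowerSeries.subst (X 1 : MvPowerSeries (Fin 2) K) φ else X l) H)) 1 = ordVarPS H 1 := by
  refine le_antisymm ?_ ?_
  · have hne : coeff (Finsupp.single 0 (degAlongPS H 1 0) + Finsupp.single 1 (ordVarPS H 1)) (cleanSeries 2 (subst
        (fun l : Fin 2 => if l = 0 then (X 0 : MvPowerSeries (Fin 2) K) + PowerSeries.subst (X 1 : MvPowerSeries (Fin 2) K) φ
        else X l) H)) ≠ 0 := by
      rw [coeff_cleanShear_row hφ hclean]; exact coeff_vertex_ne_zero hH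
    have := ordVarPS_le 1 hne
    rwa [pair_apply_one] at this
  · obtain ⟨e, he', he1⟩ := exists_coeff_apply_eq_ordVarPS 1 (cleanShear_ne_zero hφ hH hclean)
    have he := coeff_shear_ne_zero_of_cleanShear φ H (coeff_single_add_single_ne_zero he')
    rw [← he1]
    by_contra hlt
    exact he (coeff_shear_eq_zero_of_lt hφ H (e 0) (not_le.mp hlt))

/-- **`α₁(G) = α₁(H)`**. [cite: HauserWagner2014, §4 p. 191 l. 24–27] -/
theorem degAlongPS_cleanShear {φ : PowerSeries K} (hφ : PowerSeries.constantCoeff φ = 0) {H : MvPowerSeries (Fin 2) K}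
    (hH : H ≠ 0) (hclean : cleanSeries 2 H = H) :
    degAlongPS (cleanSeries 2 (subst (fun l : Fin 2 => if l = 0 then
      (X 0 : MvPowerSeries (Fin 2) K) + PowerSeries.subst (X 1 : MvPowerSeries (Fin 2) K) φ else X l) H)) 1 0 =
      degAlongPS H 1 0 := by
  have hβ := ordVarPS_cleanShear_one hφ hH hclean
  refine le_antisymm ?_ ?_
  · have hne : coeff (Finsupp.single 0 (degAlongPS H 1 0) + Finsupp.single 1 (ordVarPS H 1)) (cleanSeries 2 (subst
        (fun l : Fin 2 => if l = 0 then (X 0 : MvPowerSeries (Fin 2) K) + PowerSeries.subst (X 1 : MvPowerSeries (Fin 2) K) φ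
        else X l) H)) ≠ 0 := by
      rw [coeff_cleanShear_row hφ hclean]; exact coeff_vertex_ne_zero hH
    have := degAlongPS_le (rig := 1) (free := 0) hne (by rw [pair_apply_one, hβ])
    rwa [pair_apply_zero] at this
  · refine le_degAlongPS (cleanShear_ne_zero hφ hH hclean) fun e he' he1 => ?_
    have he := coeff_single_add_single_ne_zero he'
    rw [hβ] at he1
    rw [he1, coeff_cleanShear_row hφ hclean] at he
    have := degAlongPS_le (rig := 1) (free := 0) he (by rw [pair_apply_one])
    rwa [pair_apply_zero] at this

/-- **`ord G = ord H`**: nothing below the order survives, and the LEADING term of the sheared initial form — at the top exponent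
`deg f`, which is a clean point of `H` — does. -/
theorem order_cleanShear {φ : PowerSeries K} (hφ : PowerSeries.constantCoeff φ = 0) {H : MvPowerSeries (Fin 2) K}
    (hH : H ≠ 0) (hclean : cleanSeries 2 H = H) :
    (cleanSeries 2 (subst (fun l : Fin 2 => if l = 0 then
      (X 0 : MvPowerSeries (Fin 2) K) + PowerSeries.subst (X 1 : MvPowerSeries (Fin 2) K) φ else X l) H)).order = H.order := by
  classical
  set d := H.order.toNat with hd
  have hdH : H.order = d := (ENat.coe_toNat (fun h => hH (order_eq_top_iff.mp h))).symm
  refine le_antisymm ?_ ?_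
  · set f := ∑ b ∈ Finset.range (d + 1), Polynomial.monomial b (coeff (Finsupp.single 0 b + Finsupp.single 1 (d - b)) H)
      with hf
    have hf0 : f ≠ 0 := initialPoly_ne_zero hH rfl
    set n := f.natDegree with hn
    have hnd : n ≤ d := natDegree_initialPoly_le H d
    -- the top coefficient of `f` is a clean point of `H`
    have hlead : f.coeff n ≠ 0 := fun h => hf0 (Polynomial.leadingCoeff_eq_zero.mp h)
    have hHn : coeff (Finsupp.single 0 n + Finsupp.single 1 (d - n)) H ≠ 0 := by
      rw [hf, coeff_initialPoly, if_pos hnd] at hlead; exact hlead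
    have hnot : ¬ (2 ∣ n ∧ 2 ∣ (d - n)) := by
      intro hall
      rw [isClean_iff] at hclean
      exact hHn (hclean _ ((forall_two_dvd_pair_iff _ _).mpr hall))
    -- and it is the leading coefficient of the Taylor shift
    have htop : (Polynomial.taylor (PowerSeries.coeff 1 φ) f).coeff n ≠ 0 := by
      have h1 : (Polynomial.taylor (PowerSeries.coeff 1 φ) f).natDegree = n := Polynomial.natDegree_taylor _ _
      have h2 : (Polynomial.taylor (PowerSeries.coeff 1 φ) f).leadingCoeff = f.leadingCoeff := by
        rw [Polynomial.taylor_apply, Polynomial.leadingCoeff_comp (by rw [Polynomial.natDegree_X_add_C]; exact one_ne_zero),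
          Polynomial.leadingCoeff_X_add_C, one_pow, mul_one]
      have h3 : f.leadingCoeff ≠ 0 := Polynomial.leadingCoeff_ne_zero.mpr hf0
      rw [Polynomial.leadingCoeff, h1] at h2
      rw [h2]; exact h3
    have hc : coeff (Finsupp.single 0 n + Finsupp.single 1 (d - n)) (cleanSeries 2 (subst (fun l : Fin 2 => if l = 0 then
        (X 0 : MvPowerSeries (Fin 2) K) + PowerSeries.subst (X 1 : MvPowerSeries (Fin 2) K) φ else X l) H)) ≠ 0 := by
      rw [coeff_cleanShear_of_not_dvd φ H hnot, coeff_shear_initial hφ H rfl (show n + (d - n) = d by omega)]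
      exact htop
    refine (order_le hc).trans ?_
    rw [degree_pair, hdH]
    exact_mod_cast (by omega : n + (d - n) ≤ d)
  · exact le_trans (by rw [order_shear hφ]) (InsepCleaning.order_le_order_cleanSeries 2 _)

/-- Lower bounds on the order pass to `G` (the lift's `2 ≤ ord`). -/
theorem le_order_cleanShear {φ : PowerSeries K} (hφ : PowerSeries.constantCoeff φ = 0) {H : MvPowerSeries (Fin 2) K}
    (hH : H ≠ 0) (hclean : cleanSeries 2 H = H) {n : ℕ∞} (h : n ≤ H.order) :
    n ≤ (cleanSeries 2 (subst (fun l : Fin 2 => if l = 0 then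
      (X 0 : MvPowerSeries (Fin 2) K) + PowerSeries.subst (X 1 : MvPowerSeries (Fin 2) K) φ else X l) H)).order := by
  rw [order_cleanShear hφ hH hclean]; exact h

/-! ### Characteristic 2: clean series, odd exponents, the derivative of the initial form -/

section CharTwo

variable [CharP K 2]

/-- In characteristic `2` a natural number vanishes iff it is even. -/
theorem natCast_eq_zero_iff_two_dvd (n : ℕ) : (n : K) = 0 ↔ 2 ∣ n := CharP.cast_eq_zero_iff K 2 n

/-- … hence the dehomogenised initial form of a clean non-zero `H` of even order has NON-ZERO DERIVATIVE (the hypothesis of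
res-lit-5's `exists_coeff_comp_X_add_C_ne_zero`). [cite: HauserWagner2014, §6.1 Lemma 2 (a) p. 202] -/
theorem derivative_initialPoly_ne_zero {H : MvPowerSeries (Fin 2) K} (hH : H ≠ 0) (hclean : cleanSeries 2 H = H) {d : ℕ}
    (hd : H.order.toNat = d) (hd2 : 2 ∣ d) :
    Polynomial.derivative (∑ b ∈ Finset.range (d + 1),
      Polynomial.monomial b (coeff (Finsupp.single 0 b + Finsupp.single 1 (d - b)) H)) ≠ 0 := by
  set f := ∑ b ∈ Finset.range (d + 1), Polynomial.monomial b (coeff (Finsupp.single 0 b + Finsupp.single 1 (d - b)) H) with hf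
  have hf0 : f ≠ 0 := initialPoly_ne_zero hH hd
  -- a non-zero coefficient of `f`, necessarily at an odd exponent
  obtain ⟨b, hb⟩ : ∃ b, f.coeff b ≠ 0 := by
    by_contra h
    push Not at h
    exact hf0 (Polynomial.ext fun b => by rw [h b, Polynomial.coeff_zero])
  have hbf := hb
  rw [hf, coeff_initialPoly] at hb
  split_ifs at hb with hbd
  · have hodd := odd_of_coeff_initial_ne_zero hclean hd2 hbd hb
    have hb1 : 1 ≤ b := by
      rcases Nat.eq_zero_or_pos b with h0 | h0
      · exact absurd ⟨0, by rw [h0]⟩ hodd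
      · exact h0
    intro hder
    have h := congrArg (fun p : Polynomial K => p.coeff (b - 1)) hder
    simp only [Polynomial.coeff_derivative, Polynomial.coeff_zero] at h
    rw [show b - 1 + 1 = b by omega] at h
    have hcast : ((b - 1 : ℕ) : K) + 1 = (b : K) := by
      rw [← Nat.cast_succ]; congr 1; omega
    rw [hcast] at h
    rcases mul_eq_zero.mp h with h | h
    · exact hbf h
    · exact hodd ((natCast_eq_zero_iff_two_dvd b).mp h)
  · exact absurd rfl hb

/-! ### [HW14] Lemma 3: a low point on the cleaned initial line of the sheared series -/

/-- **[HW14] LEMMA 3 (with Lemma 2 = Moh's bound), support form.**  `H` clean and non-zero of order `d`, `φ(0) = 0` with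
LINEAR PART `t = [z¹]φ ≠ 0`.  Then the sheared series `θ_φ^* H` has, on the initial line, a point `(i, d − i)` which SURVIVES
CLEANING (`i`, `d − i` not both even) with `i ≤ height(H) + parity(d)` (`parity(d) = 1` if `2 ∣ d`, else `0`): for odd `d` the
`y`-order of the sheared initial form is at most `height(F_d) ≤ height(F)` (Lemma 2 (b)); for even `d` the class modulo squares
has `y`-order at most `height(F_d) + 1` (Lemma 2 (a), the derivative trick).
[cite: HauserWagner2014, §6.1 Lemma 3 p. 203; Lemma 2 p. 202; Lemma 1 p. 201] -/
theorem exists_initial_coeff_shear {φ : PowerSeries K} (hφ : PowerSeries.constantCoeff φ = 0) (ht : PowerSeries.coeff 1 φ ≠ 0)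
    {H : MvPowerSeries (Fin 2) K} (hH : H ≠ 0) (hclean : cleanSeries 2 H = H) {d : ℕ} (hd : H.order.toNat = d) :
    ∃ i : ℕ, i ≤ d ∧ i ≤ heightPS H 1 0 + (if 2 ∣ d then 1 else 0) ∧ ¬ (2 ∣ i ∧ 2 ∣ (d - i)) ∧
      coeff (Finsupp.single 0 i + Finsupp.single 1 (d - i)) (subst (fun l : Fin 2 => if l = 0 then
        (X 0 : MvPowerSeries (Fin 2) K) + PowerSeries.subst (X 1 : MvPowerSeries (Fin 2) K) φ else X l) H) ≠ 0 := by
  set f := ∑ b ∈ Finset.range (d + 1), Polynomial.monomial b (coeff (Finsupp.single 0 b + Finsupp.single 1 (d - b)) H) with hf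
  have hf0 : f ≠ 0 := initialPoly_ne_zero hH hd
  have hfd : f.natDegree ≤ d := natDegree_initialPoly_le H d
  have hheight : f.natDegree - f.natTrailingDegree ≤ heightPS H 1 0 := height_initialPoly_le_heightPS hH hd
  have htaylor : Polynomial.taylor (PowerSeries.coeff 1 φ) f = f.comp (Polynomial.X + Polynomial.C (PowerSeries.coeff 1 φ)) :=
    Polynomial.taylor_apply _ _
  have hcomp0 : f.comp (Polynomial.X + Polynomial.C (PowerSeries.coeff 1 φ)) ≠ 0 := by
    rw [← htaylor, Ne, Polynomial.taylor_eq_zero]; exact hf0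
  have hcompdeg : (f.comp (Polynomial.X + Polynomial.C (PowerSeries.coeff 1 φ))).natDegree ≤ d := by
    rw [← htaylor, Polynomial.natDegree_taylor]; exact hfd
  -- the coefficient on the initial line is the Taylor coefficient
  have hline : ∀ i ≤ d, coeff (Finsupp.single 0 i + Finsupp.single 1 (d - i)) (subst (fun l : Fin 2 => if l = 0 then
      (X 0 : MvPowerSeries (Fin 2) K) + PowerSeries.subst (X 1 : MvPowerSeries (Fin 2) K) φ else X l) H) =
      (f.comp (Polynomial.X + Polynomial.C (PowerSeries.coeff 1 φ))).coeff i := fun i hi => by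
    rw [coeff_shear_initial hφ H hd (show i + (d - i) = d by omega), ← htaylor]
  by_cases hd2 : 2 ∣ d
  · -- parity 1: the derivative trick
    obtain ⟨a, ha, haK, hale⟩ := HauserWagner2014.exists_coeff_comp_X_add_C_ne_zero
      (derivative_initialPoly_ne_zero hH hclean hd hd2) ht
    have had : a ≤ d := (Polynomial.le_natDegree_of_ne_zero ha).trans hcompdeg
    have hale' : a ≤ f.natDegree - f.natTrailingDegree + 1 := hale
    refine ⟨a, had, ?_, ?_, ?_⟩
    · rw [if_pos hd2]; omega
    · rintro ⟨h2a, -⟩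
      exact haK ((natCast_eq_zero_iff_two_dvd a).mpr h2a)
    · rw [hline a had]; exact ha
  · -- parity 0: the trailing coefficient
    set i := (f.comp (Polynomial.X + Polynomial.C (PowerSeries.coeff 1 φ))).natTrailingDegree with hi
    have hid : i ≤ d := (Polynomial.natTrailingDegree_le_natDegree _).trans hcompdeg
    refine ⟨i, hid, ?_, ?_, ?_⟩
    · rw [if_neg hd2, add_zero]
      exact (HauserWagner2014.natTrailingDegree_comp_X_add_C_le hf0 ht).trans hheight
    · rintro ⟨⟨m, hm⟩, ⟨n, hn⟩⟩
      exact hd2 ⟨m + n, by omega⟩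
    · rw [hline i hid]
      exact Polynomial.trailingCoeff_nonzero_iff_nonzero.mpr hcomp0

/-- **[HW14] LEMMA 3 FOR THE CLEANED SHEAR**: `G = clean₂(θ_φ^* H)` (`[z¹]φ ≠ 0`) has on its initial line `i + a = d = ord H` a
support point with free exponent `i ≤ height(H) + parity(d)`. [cite: HauserWagner2014, §6.1 Lemma 3 p. 203] -/
theorem exists_initial_coeff_cleanShear {φ : PowerSeries K} (hφ : PowerSeries.constantCoeff φ = 0)
    (ht : PowerSeries.coeff 1 φ ≠ 0) {H : MvPowerSeries (Fin 2) K} (hH : H ≠ 0) (hclean : cleanSeries 2 H = H) {d : ℕ}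
    (hd : H.order.toNat = d) :
    ∃ i : ℕ, i ≤ d ∧ i ≤ heightPS H 1 0 + (if 2 ∣ d then 1 else 0) ∧
      coeff (Finsupp.single 0 i + Finsupp.single 1 (d - i)) (cleanSeries 2 (subst (fun l : Fin 2 => if l = 0 then
        (X 0 : MvPowerSeries (Fin 2) K) + PowerSeries.subst (X 1 : MvPowerSeries (Fin 2) K) φ else X l) H)) ≠ 0 := by
  obtain ⟨i, hid, hi, hnot, hc⟩ := exists_initial_coeff_shear hφ ht hH hclean hd
  exact ⟨i, hid, hi, by rwa [coeff_cleanShear_of_not_dvd φ H hnot]⟩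

/-! ### The horizontal successor of `G`: `deg_free(A″) ≤ height(H) + parity(d)` -/

/-- **THE HIGHEST VERTEX OF THE (T)-SUCCESSOR** (Hauser–Wagner's `deg_y(F*)`): if `π_H(c₁)^* G = X₀² A″` (`c₁ ≠ 0`, new rigid `= 0`,
free `= 1`) for `G = clean₂(θ_φ^* H)` with `[z¹]φ ≠ 0`, `H` clean non-zero of order `d ≥ 2`, then
`deg_free(A″) ≤ height(H) + parity(d)`. [cite: HauserWagner2014, §6.1 Lemma 3 p. 203, Prop. 2 p. 204 (the chain `height(F*) ≤ deg_y(F*) − … ≤ height(F_d) + parity(d) − …`)] -/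
theorem degAlongPS_tSucc_le {φ : PowerSeries K} (hφ : PowerSeries.constantCoeff φ = 0) (ht : PowerSeries.coeff 1 φ ≠ 0)
    {H : MvPowerSeries (Fin 2) K} (hH : H ≠ 0) (hclean : cleanSeries 2 H = H) (hH2 : (2 : ℕ∞) ≤ H.order) {d : ℕ}
    (hd : H.order.toNat = d) {c₁ : K} (hc₁ : c₁ ≠ 0) {A'' : MvPowerSeries (Fin 2) K}
    (hfac : subst (fun l : Fin 2 => if l = 1 then C c₁ * X 0 else (X 0 * X 1 : MvPowerSeries (Fin 2) K))
      (cleanSeries 2 (subst (fun l : Fin 2 => if l = 0 then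
        (X 0 : MvPowerSeries (Fin 2) K) + PowerSeries.subst (X 1 : MvPowerSeries (Fin 2) K) φ else X l) H)) = X 0 ^ 2 * A'') :
    degAlongPS A'' 0 1 ≤ heightPS H 1 0 + (if 2 ∣ d then 1 else 0) := by
  set G := cleanSeries 2 (subst (fun l : Fin 2 => if l = 0 then
    (X 0 : MvPowerSeries (Fin 2) K) + PowerSeries.subst (X 1 : MvPowerSeries (Fin 2) K) φ else X l) H) with hG
  have hG0 : G ≠ 0 := cleanShear_ne_zero hφ hH hclean
  have hG2 : (2 : ℕ∞) ≤ G.order := le_order_cleanShear hφ hH hclean hH2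
  have hGd : G.order = d := by
    rw [hG, order_cleanShear hφ hH hclean, ← hd]
    exact (ENat.coe_toNat (fun h => hH (order_eq_top_iff.mp h))).symm
  obtain ⟨i, hid, hi, hc⟩ := exists_initial_coeff_cleanShear hφ ht hH hclean hd
  -- the point `(i, d − i)` of `G` is transported to `(d − 2, i)` on the lowest rigid row of `A″`
  have h2 : 2 ≤ i + (d - i) := by
    have := two_le_add_of_coeff_ne_zero hG2 hc
    exact this
  have hc' := coeff_hSucc_ne_zero_of hc₁ hfac h2 hc
  have hrow : (Finsupp.single (0 : Fin 2) (i + (d - i) - 2) + Finsupp.single 1 i : Fin 2 →₀ ℕ) 0 = ordVarPS A'' 0 := by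
    rw [pair_apply_zero]
    have hz := ordVarPS_hSucc_zero hc₁ hG0 hG2 hfac
    rw [hGd] at hz
    have hz' : ordVarPS A'' 0 + 2 = d := by exact_mod_cast hz
    omega
  have hle := degAlongPS_le (rig := 0) (free := 1) hc' hrow
  rw [pair_apply_one] at hle
  exact hle.trans hi

/-- … equivalently **`height(A″) + ord_free(A″) ≤ height(H) + parity(d)`**, with `ord_free(A″) = ord_free(G)` (the free order is read
AFTER the shear: `(T)` forced ⇔ it dropped). [cite: HauserWagner2014, §6.1 Prop. 2 p. 204] -/
theorem heightPS_tSucc_add_le {φ : PowerSeries K} (hφ : PowerSeries.constantCoeff φ = 0) (ht : PowerSeries.coeff 1 φ ≠ 0)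
    {H : MvPowerSeries (Fin 2) K} (hH : H ≠ 0) (hclean : cleanSeries 2 H = H) (hH2 : (2 : ℕ∞) ≤ H.order) {d : ℕ}
    (hd : H.order.toNat = d) {c₁ : K} (hc₁ : c₁ ≠ 0) {A'' : MvPowerSeries (Fin 2) K}
    (hfac : subst (fun l : Fin 2 => if l = 1 then C c₁ * X 0 else (X 0 * X 1 : MvPowerSeries (Fin 2) K))
      (cleanSeries 2 (subst (fun l : Fin 2 => if l = 0 then
        (X 0 : MvPowerSeries (Fin 2) K) + PowerSeries.subst (X 1 : MvPowerSeries (Fin 2) K) φ else X l) H)) = X 0 ^ 2 * A'') :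
    heightPS A'' 0 1 + ordVarPS (cleanSeries 2 (subst (fun l : Fin 2 => if l = 0 then
        (X 0 : MvPowerSeries (Fin 2) K) + PowerSeries.subst (X 1 : MvPowerSeries (Fin 2) K) φ else X l) H)) 0 ≤
      heightPS H 1 0 + (if 2 ∣ d then 1 else 0) := by
  have hG0 := cleanShear_ne_zero hφ hH hclean
  have hG2 := le_order_cleanShear hφ hH hclean hH2
  have h1 := degAlongPS_tSucc_le hφ ht hH hclean hH2 hd hc₁ hfac
  have h2 := ordVarPS_hSucc_one hc₁ hG0 hG2 hfac
  have h3 := ordVarPS_le_degAlongPS (hSucc_ne_zero hc₁ hG0 hG2 hfac) 0 1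
  rw [heightPS, ← h2]
  omega

end CharTwo

end InsepNewton

end Summit.ResolutionOfSingularities.ResolutionOfSingularities.Theorems
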